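import Literature.NumberTheory.Li1992.RallisOrbitUnfolding
import HarnessLib

/-!
# H413 ∕ E-2 (S6, Rallis' inner product formula): the parent line's stub R3′ `stub_E2R3_unfold`, CLOSED

Crux H413 (stmt-HodgeConjecture-24833), engine E-2, parent line `Cruxes/H413/Lines/F0_E2RallisInnerProduct.lean` (F0-typ2 (g0) v0.1
6b8e670f, letters F0P4-plan (g3) `E2-LETTERS.v1` §A; director g14 s393).  The TYPE of `E2Unfold.unfold` below is the body of the line's
`stub_E2R3_unfold` VERBATIM (generic unfolding over a discrete cocompact `Γ ≤ G`: `∃ a > 0`, for every continuous `c` with uniformly bounded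
absolute orbit sums `Σ_γ |c(x₂γx₁⁻¹)|`, every continuous `K` with `K(x₁Γ,x₂Γ) = Σ_γ c(x₂γx₁⁻¹)` and all `f₁ f₂ ∈ C(G ⧸ Γ, ℂ)`,
`h ↦ c(h)⟨π(h)f₁,f₂⟩_μ` is integrable and `∫∫ f₁ \overline{f₂} K dμ dμ = a ∫ c(h) ⟨π(h)f₁,f₂⟩_μ dh`); the PROOF is ★ p797384
`Literature.NumberTheory.Li1992.exists_unfold_orbitSum_eq_mul_integral_regularCoeff` ([Li1992, (24)–(26)]; [HarrisKudlaSweet1996, (1.2)–(1.4)];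
Weil's formula ★ `InvariantQuotientUnfoldingBochner`), after reading `μ ≠ 0` off `[μ.IsOpenPosMeasure]` and dropping the (unused) continuity of `K`.
Registrar fold: `theorem stub_E2R3_unfold : … := E2Unfold.unfold`.  KERNEL: one theorem, no definition, no `sorry`.
HC_CM is proved only modulo the printed citations until rung 0 closes.

[cite: Li1992, (24)–(26) pp. 182–184] [cite: HarrisKudlaSweet1996, §1 (1.2)–(1.4)]
-/

set_option autoImplicit false
set_option linter.dupNamespace false

noncomputable section

open _root_.MeasureTheory
open scoped ComplexConjugate
open Literature.NumberTheory.Li1992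

namespace Summit.HodgeConjecture.HodgeConjecture.Cruxes.H413.E2Unfold

/-- **R3′ `stub_E2R3_unfold` of the E-2 parent line, as lettered** (generic unfolding of the orbit sum `Σ_γ c(x₂γx₁⁻¹)` against `f₁ ⊗ \overline{f₂}`
on `(G ⧸ Γ)²` to `a ∫_G c(h) ⟨π(h)f₁,f₂⟩_μ dh`, ONE `a > 0` for all data) — ★ `Li1992.exists_unfold_orbitSum_eq_mul_integral_regularCoeff`.
[cite: Li1992, (24)–(26) pp. 182–184] [cite: HarrisKudlaSweet1996, §1 (1.2)–(1.4)] -/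
theorem unfold : ∀ {G : Type*} [Group G] [TopologicalSpace G] [IsTopologicalGroup G] [LocallyCompactSpace G]
    [T2Space G] [SecondCountableTopology G] [MeasurableSpace G] [BorelSpace G] {Γ : Subgroup G} [DiscreteTopology Γ]
    (dh : Measure G) [dh.IsHaarMeasure] [dh.IsMulRightInvariant]
    [CompactSpace (G ⧸ Γ)] [MeasurableSpace (G ⧸ Γ)] [BorelSpace (G ⧸ Γ)] (μ : Measure (G ⧸ Γ)) [IsFiniteMeasure μ]
    [μ.IsOpenPosMeasure] [SMulInvariantMeasure G (G ⧸ Γ) μ],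
    ∃ a : ℝ, 0 < a ∧ ∀ (c : G → ℂ), Continuous c → ∀ (B : ℝ),
      (∀ x₁ x₂ : G, Summable (fun γ : Γ => ‖c (x₂ * (γ : G) * x₁⁻¹)‖) ∧ ∑' γ : Γ, ‖c (x₂ * (γ : G) * x₁⁻¹)‖ ≤ B) →
      ∀ (K : G ⧸ Γ → G ⧸ Γ → ℂ), Continuous (Function.uncurry K) →
        (∀ x₁ x₂ : G, K (x₁ : G ⧸ Γ) (x₂ : G ⧸ Γ) = ∑' γ : Γ, c (x₂ * (γ : G) * x₁⁻¹)) →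
        ∀ (f₁ f₂ : C(G ⧸ Γ, ℂ)),
          Integrable (fun h => c h * regularCoeff μ h f₁ f₂) dh ∧
            ∫ q₁, ∫ q₂, f₁ q₁ * conj (f₂ q₂) * K q₁ q₂ ∂μ ∂μ = (a : ℂ) * ∫ h, c h * regularCoeff μ h f₁ f₂ ∂dh := by
  intro G _ _ _ _ _ _ _ _ Γ _ dh _ _ _ _ _ μ _ hop _
  have hμ : μ ≠ 0 := by
    intro h0
    have h := hop.open_pos Set.univ isOpen_univ Set.univ_nonempty
    rw [h0] at h
    exact h rfl
  obtain ⟨a, ha, h⟩ := exists_unfold_orbitSum_eq_mul_integral_regularCoeff Γ μ dh hμ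
  exact ⟨a, ha, fun c hc B hbd K _ hK f₁ f₂ =>
    h c hc B (fun x₁ x₂ => (hbd x₁ x₂).1) (fun x₁ x₂ => (hbd x₁ x₂).2) K hK f₁ f₂⟩

end Summit.HodgeConjecture.HodgeConjecture.Cruxes.H413.E2Unfold

end
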